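import Mathlib
import HarnessLib
import Summits.ValiantsHypothesis.ValiantsHypothesis.Theorems.LacunarySymmetroidMatrixDescartesProductPlusOneCrossingInterlace
import Summits.ValiantsHypothesis.ValiantsHypothesis.Theorems.KPlusLogSqLawTridiagonalRealStaticPotentialRow

/-!
# Tower graft line — THE FAR EXPONENT IS FREE AFTER TWO ROLLE STEPS (I): a `D`-uniform, coupling-uniform count for the
# two-digit graft `A + a·X^D·E`

Mechanism file for LINE (B) `Cruxes/WeakLifting/Lines/tower_graft.lean` (crux `WeakLifting` = stmt-ValiantsHypothesis-19561;
rung S4b `TowerGraftLawCorner`, whose object is the two-digit graft `det (G + X^D·eᵢeᵢᵀ) = det G + X^D·det Gᵢᵢ`).  NO stub is claimed.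
Part I (this file): the law for two arbitrary real polynomials.  Part II (`…TowerGraftInflectionLawCorner`): the corner graft in
pencil and class form and the reduction offered to the line.

THE LAW (`card_posRoots_twoDigit_le`).  For ALL real polynomials `A, E`, every real coupling `a` and EVERY exponent `D`
(no steepness, no digit separation asked):

  `Z₊(A + a·X^D·E) ≤ Z₊(𝓘(A,E)) + 4·Z₊(A) + 2·Z₊(E) + 2`,   `𝓘(A,E) := W(A·E, X·W(E,A))`,

`W(f,g) = f g′ − f′ g` Mathlib's `Polynomial.wronskian`, `Z₊` = number of DISTINCT positive zeros (the census currency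
`roots.toFinset.filter (0 < ·)`).  The right-hand side does not depend on `D` or `a`: along the whole two-parameter family of grafts
of the digit `E` onto the digit `A` the positive-zero count is bounded by ONE `D`-free polynomial attached to the pair.  Reading:
off the zeros of `A·E`, `𝓘/(A E)² = (d/dX)(θ log|A| − θ log|E|)` with `θ = X·d/dX`, so `Z₊(𝓘)` counts the points where the
log–log plots of `|A|` and `|E|` have EQUAL CURVATURE («common inflections of the pair»); equivalently
`X·𝓘 = 𝒲(A)·E² − 𝒲(E)·A²` with the log-Wronskian `𝒲(P) = P·θ²P − (θP)²` of the tree's `…ProductPlusOneCrossingInterlace`.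

PROOF.  Two Rolle steps in LEVEL form (`card_posRoots_level_le`: for `Q ≠ 0` and every level `c`,
`Z₊(N − c·Q) ≤ Z₊(W(Q,N)) + 2·Z₊(Q) + 1` — between two zeros of `N − cQ` in a `Q`-free window the quotient `N/Q` takes the value `c`
twice, so `(N/Q)′ = W(Q,N)/Q²` vanishes in between (Mathlib's Rolle `exists_hasDerivAt_eq_zero`); zeros AT the poles are charged to
`Z₊(Q)`; the degenerate case `W(Q,N) = 0` forces `N/Q` locally constant, hence `N − cQ = 0` (mean value theorem + a polynomial
vanishing on an interval is zero), whose root multiset is empty by convention; the interlacing count is the tree's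
`ProductPlusOne.card_le_card_add_one_of_between`).  STEP 1 at level `c = −1` with `N = a·X^D·E`, `Q = A`:
`X·W(A, a X^D E) = −a·X^D·(X·W(E,A) − D·A·E)` (`X_mul_wronskian_graft`), so the separators are the positive zeros of
`U_D := X·W(E,A) − D·(A·E)`.  STEP 2: `U_D` is itself a LEVEL SET — level `D` of `X·W(E,A)` against `Q₂ = A·E` — so the same lemma
bounds `Z₊(U_D)` by `Z₊(W(A E, X·W(E,A))) + 2·Z₊(A·E) + 1`, and the level `D` has disappeared.  (Compare the tree's ONE-polynomial
version `ProductPlusOne.card_posRoots_thetaSub_le_wronskian_add`, `Z₊(X·P′ − ν·P) ≤ Z₊(𝒲(P)) + 2·Z₊(P) + 1`, for the class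
`∏ f_j + c·X^N` of 18050's LINE (A): there the Euler operator kills a MONOMIAL graft; here the graft carries a digit `E`.)

HONEST FRAMING: Rolle bookkeeping; nothing here proves S4 (`TowerGraftLawId`), S4b (`TowerGraftLawCorner`), S4d/S4f, S5
(`TowerGraftLaw`), S5ᴸ, TowerB, `WeakLifting`, Conjecture B, `MatrixDescartes` (18050) or anything about `VP ≠ VNP`.  Def-free;
Mathlib + the tree's `…ProductPlusOneCrossingInterlace` (interlacing count) and `…TridiagonalRealStaticPotentialRow` (`Z₊(P·Q) ≤ Z₊(P) + Z₊(Q)`, cited).  Seat: prover leafhand-val-kpluslogsqlaw-1 g8,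
`--supports stmt-ValiantsHypothesis-19561 --as helper`.  [folklore: Rolle / Wronskian counting (Pólya–Szegő, Problems and Theorems in
Analysis II, Part V; Voorhoeve–van der Poorten 1975, doi:10.1016/1385-7258(75)90050-5; Koiran–Portier–Tavenas 2015, «A Wronskian
approach to the real τ-conjecture», doi:10.1016/j.jsc.2014.09.036); the level-uniform packaging for the two-digit graft is this work]
-/

-- `Summit.ValiantsHypothesis.ValiantsHypothesis.…` repeats a component by the D-0017 layout
-- (single-conjunct summit), which the `dupNamespace` linter flags; the name is mandated.
set_option linter.dupNamespace false
set_option autoImplicit false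

namespace Summit.ValiantsHypothesis.ValiantsHypothesis.Theorems.KPlusLogSqLaw.TowerGraft

open Polynomial Finset
open scoped BigOperators Polynomial
open Summit.ValiantsHypothesis.ValiantsHypothesis.Theorems.LacunarySymmetroidMatrixDescartes.ProductPlusOne
  (card_le_card_add_one_of_between)

namespace InflectionLaw

/-! ## §1 One Rolle step in LEVEL form: `Z₊(N − c·Q) ≤ Z₊(W(Q,N)) + 2·Z₊(Q) + 1` for every level `c` -/

/-- evaluation of Mathlib's Wronskian `W(Q,N) = Q N′ − Q′ N`. [folklore] -/
theorem eval_wronskian (Q N : ℝ[X]) (x : ℝ) :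
    (wronskian Q N).eval x = Q.eval x * (derivative N).eval x - (derivative Q).eval x * N.eval x := by
  simp [wronskian]

/-- derivative of the quotient of two polynomial functions off the zeros of the denominator. [folklore] -/
theorem hasDerivAt_div_eval (N Q : ℝ[X]) {x : ℝ} (hx : Q.eval x ≠ 0) :
    HasDerivAt (fun t => N.eval t / Q.eval t)
      (((derivative N).eval x * Q.eval x - N.eval x * (derivative Q).eval x) / Q.eval x ^ 2) x :=
  (N.hasDerivAt x).div (Q.hasDerivAt x) hx

/-- **Rolle for a quotient.**  If `N/Q` takes the same value `c` at `z < z'` and `Q` has no zero on `[z, z']`, then the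
Wronskian `W(Q,N)` vanishes strictly in between. [folklore] -/
theorem exists_wronskian_root_of_level {N Q : ℝ[X]} {c z z' : ℝ} (hzz' : z < z')
    (hQ : ∀ t ∈ Set.Icc z z', Q.eval t ≠ 0)
    (hz : N.eval z = c * Q.eval z) (hz' : N.eval z' = c * Q.eval z') :
    ∃ w ∈ Set.Ioo z z', (wronskian Q N).eval w = 0 := by
  have hcont : ContinuousOn (fun t => N.eval t / Q.eval t) (Set.Icc z z') :=
    N.continuousOn.div Q.continuousOn hQ
  have hQz : Q.eval z ≠ 0 := hQ z ⟨le_rfl, hzz'.le⟩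
  have hQz' : Q.eval z' ≠ 0 := hQ z' ⟨hzz'.le, le_rfl⟩
  have hends : N.eval z / Q.eval z = N.eval z' / Q.eval z' := by
    rw [hz, hz', mul_div_assoc, mul_div_assoc, div_self hQz, div_self hQz']
  obtain ⟨w, hw, hw0⟩ := exists_hasDerivAt_eq_zero hzz' hcont hends
    (fun x hx => hasDerivAt_div_eval N Q (hQ x (Set.Ioo_subset_Icc_self hx)))
  refine ⟨w, hw, ?_⟩
  have hQw := hQ w (Set.Ioo_subset_Icc_self hw)
  rw [div_eq_zero_iff] at hw0
  rcases hw0 with h | h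
  · rw [eval_wronskian]; linear_combination h
  · exact absurd (pow_eq_zero_iff two_ne_zero |>.mp h) hQw

/-- **Degenerate case.**  If `W(Q,N) = 0` and `N/Q = c` at a point `z` with `Q(z) ≠ 0`, then `N − c·Q = 0`: the quotient is
locally constant (mean value theorem), so `N − c·Q` vanishes on an interval. [folklore] -/
theorem sub_eq_zero_of_wronskian_eq_zero {N Q : ℝ[X]} {c z : ℝ} (hW : wronskian Q N = 0)
    (hQz : Q.eval z ≠ 0) (hz : N.eval z = c * Q.eval z) : N - C c * Q = 0 := by
  -- `Q ≠ 0` on a neighbourhood of `z`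
  obtain ⟨δ, hδ, hball⟩ : ∃ δ > 0, ∀ t, |t - z| < δ → Q.eval t ≠ 0 := by
    have hev := (Q.continuous.continuousAt (x := z)).eventually_ne hQz
    rw [Metric.eventually_nhds_iff] at hev
    obtain ⟨δ, hδ, h⟩ := hev
    exact ⟨δ, hδ, fun t ht => h (by rwa [Real.dist_eq])⟩
  -- on `(z, z + δ)` the quotient equals `c`
  have hconst : ∀ t ∈ Set.Ioo z (z + δ), N.eval t = c * Q.eval t := by
    intro t ht
    have hQI : ∀ s ∈ Set.Icc z t, Q.eval s ≠ 0 := fun s hs =>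
      hball s (by rw [abs_lt]; constructor <;> linarith [hs.1, hs.2, ht.2])
    obtain ⟨w, hw, hslope⟩ := exists_hasDerivAt_eq_slope (fun s => N.eval s / Q.eval s)
      (fun s => ((derivative N).eval s * Q.eval s - N.eval s * (derivative Q).eval s) / Q.eval s ^ 2)
      ht.1 (N.continuousOn.div Q.continuousOn hQI)
      (fun s hs => hasDerivAt_div_eval N Q (hQI s (Set.Ioo_subset_Icc_self hs)))
    have hnum : (derivative N).eval w * Q.eval w - N.eval w * (derivative Q).eval w = 0 := by
      have h0 := congrArg (fun p => Polynomial.eval w p) hW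
      simp only [eval_wronskian, eval_zero] at h0
      linear_combination h0
    rw [hnum, zero_div] at hslope
    have htz : t - z ≠ 0 := sub_ne_zero.2 (ne_of_gt ht.1)
    have hQt : Q.eval t ≠ 0 := hQI t ⟨ht.1.le, le_rfl⟩
    have hdiff : N.eval t / Q.eval t - N.eval z / Q.eval z = 0 := by
      rcases (div_eq_zero_iff.mp hslope.symm) with h | h
      · exact h
      · exact absurd h htz
    have hfz : N.eval z / Q.eval z = c := by rw [hz, mul_div_assoc, div_self hQz, mul_one]
    have hft : N.eval t / Q.eval t = c := by linarith
    rwa [div_eq_iff hQt] at hft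
  -- hence `N − c·Q` has infinitely many roots
  apply Polynomial.eq_zero_of_infinite_isRoot
  refine Set.Infinite.mono (fun t ht => ?_) (Set.Ioo_infinite (show z < z + δ by linarith))
  simp only [Set.mem_setOf_eq, IsRoot.def, eval_sub, eval_mul, eval_C]
  linarith [hconst t ht]

/-- the zeros of a level set `N − c·Q` OFF the zeros of `Q` are separated by zeros of `W(Q,N)` or of `Q`:
`#{x > 0 : (N − cQ)(x) = 0, Q(x) ≠ 0} ≤ Z₊(W(Q,N)) + Z₊(Q) + 1`. [folklore; this file's packaging] -/
theorem card_level_off_poles_le (N Q : ℝ[X]) (c : ℝ) :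
    ((N - C c * Q).roots.toFinset.filter (fun x => 0 < x ∧ Q.eval x ≠ 0)).card ≤
      ((wronskian Q N).roots.toFinset.filter (fun x => 0 < x)).card +
        (Q.roots.toFinset.filter (fun x => 0 < x)).card + 1 := by
  classical
  by_cases hW : wronskian Q N = 0
  · have hempty : (N - C c * Q).roots.toFinset.filter (fun x => 0 < x ∧ Q.eval x ≠ 0) = ∅ := by
      rw [Finset.filter_eq_empty_iff]
      rintro z hz ⟨-, hQz⟩
      rw [Multiset.mem_toFinset] at hz
      obtain ⟨hne, hroot⟩ := mem_roots'.1 hz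
      apply hne
      apply sub_eq_zero_of_wronskian_eq_zero hW hQz
      rw [IsRoot.def, eval_sub, eval_mul, eval_C] at hroot
      linarith
    rw [hempty]; simp
  by_cases hQ0 : Q = 0
  · have hempty : (N - C c * Q).roots.toFinset.filter (fun x => 0 < x ∧ Q.eval x ≠ 0) = ∅ := by
      rw [Finset.filter_eq_empty_iff]
      rintro z - ⟨-, h⟩
      exact h (by rw [hQ0, eval_zero])
    rw [hempty]; simp
  refine (card_le_card_add_one_of_between _
    (((wronskian Q N).roots.toFinset.filter (fun x => 0 < x)) ∪ (Q.roots.toFinset.filter (fun x => 0 < x)))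
    ?_).trans ?_
  · intro z hz z' hz' hzz'
    simp only [Finset.mem_filter, Multiset.mem_toFinset] at hz hz'
    by_cases hmid : ∃ w ∈ Set.Ioo z z', Q.eval w = 0
    · obtain ⟨w, hw, hQw⟩ := hmid
      refine ⟨w, ?_, hw.1, hw.2⟩
      rw [Finset.mem_union]
      refine Or.inr ?_
      rw [Finset.mem_filter, Multiset.mem_toFinset, mem_roots hQ0]
      exact ⟨hQw, hz.2.1.trans hw.1⟩
    · push Not at hmid
      have hQI : ∀ t ∈ Set.Icc z z', Q.eval t ≠ 0 := by
        intro t ht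
        rcases eq_or_lt_of_le ht.1 with h | h
        · rw [← h]; exact hz.2.2
        rcases eq_or_lt_of_le ht.2 with h' | h'
        · rw [h']; exact hz'.2.2
        · exact hmid t ⟨h, h'⟩
      have hNz : N.eval z = c * Q.eval z := by
        have h := (mem_roots'.1 hz.1).2
        rw [IsRoot.def, eval_sub, eval_mul, eval_C] at h
        linarith
      have hNz' : N.eval z' = c * Q.eval z' := by
        have h := (mem_roots'.1 hz'.1).2
        rw [IsRoot.def, eval_sub, eval_mul, eval_C] at h
        linarith
      obtain ⟨w, hw, hw0⟩ := exists_wronskian_root_of_level hzz' hQI hNz hNz'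
      refine ⟨w, ?_, hw.1, hw.2⟩
      rw [Finset.mem_union]
      refine Or.inl ?_
      rw [Finset.mem_filter, Multiset.mem_toFinset, mem_roots hW]
      exact ⟨hw0, hz.2.1.trans hw.1⟩
  · have := Finset.card_union_le ((wronskian Q N).roots.toFinset.filter (fun x => 0 < x))
      (Q.roots.toFinset.filter (fun x => 0 < x))
    omega

/-- the positive zeros of `F` split into those off the zeros of `Q ≠ 0` and at most `Z₊(Q)` others. [folklore] -/
theorem card_posRoots_le_off_poles_add (F Q : ℝ[X]) (hQ : Q ≠ 0) :
    (F.roots.toFinset.filter (fun x => 0 < x)).card ≤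
      (F.roots.toFinset.filter (fun x => 0 < x ∧ Q.eval x ≠ 0)).card +
        (Q.roots.toFinset.filter (fun x => 0 < x)).card := by
  classical
  calc (F.roots.toFinset.filter (fun x => 0 < x)).card
      ≤ ((F.roots.toFinset.filter (fun x => 0 < x ∧ Q.eval x ≠ 0)) ∪
          (Q.roots.toFinset.filter (fun x => 0 < x))).card := by
        refine Finset.card_le_card fun x hx => ?_
        rw [Finset.mem_filter] at hx
        rw [Finset.mem_union, Finset.mem_filter, Finset.mem_filter]
        by_cases h : Q.eval x = 0
        · refine Or.inr ⟨?_, hx.2⟩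
          rw [Multiset.mem_toFinset, mem_roots hQ]
          exact h
        · exact Or.inl ⟨hx.1, hx.2, h⟩
    _ ≤ _ := Finset.card_union_le _ _

/-- **ONE ROLLE STEP, LEVEL FORM.**  For every `N`, every `Q ≠ 0` and EVERY level `c`:
`Z₊(N − c·Q) ≤ Z₊(W(Q,N)) + 2·Z₊(Q) + 1` — the right-hand side does not see the level. [folklore; this file's packaging] -/
theorem card_posRoots_level_le (N Q : ℝ[X]) (c : ℝ) (hQ : Q ≠ 0) :
    ((N - C c * Q).roots.toFinset.filter (fun x => 0 < x)).card ≤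
      ((wronskian Q N).roots.toFinset.filter (fun x => 0 < x)).card +
        2 * (Q.roots.toFinset.filter (fun x => 0 < x)).card + 1 := by
  have h1 := card_posRoots_le_off_poles_add (N - C c * Q) Q hQ
  have h2 := card_level_off_poles_le N Q c
  omega

/-! ## §2 The two-digit graft: step 1 at level `−1`, step 2 at level `D` -/

/-- positive zeros of `a·X^D·E` are positive zeros of `E`. [folklore] -/
theorem card_posRoots_C_mul_X_pow_mul_le (a : ℝ) (D : ℕ) (E : ℝ[X]) :
    ((C a * X ^ D * E).roots.toFinset.filter (fun x => 0 < x)).card ≤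
      (E.roots.toFinset.filter (fun x => 0 < x)).card := by
  classical
  by_cases h0 : C a * X ^ D * E = 0
  · rw [h0]; simp
  have hE : E ≠ 0 := fun h => h0 (by rw [h, mul_zero])
  refine Finset.card_le_card fun x hx => ?_
  rw [Finset.mem_filter, Multiset.mem_toFinset, mem_roots h0, IsRoot.def] at hx
  rw [Finset.mem_filter, Multiset.mem_toFinset, mem_roots hE, IsRoot.def]
  refine ⟨?_, hx.2⟩
  simp only [eval_mul, eval_C, eval_pow, eval_X] at hx
  rcases mul_eq_zero.1 hx.1 with h | h
  · rcases mul_eq_zero.1 h with h' | h'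
    · exact absurd (by rw [h', C_0, zero_mul, zero_mul]) h0
    · exact absurd h' (pow_ne_zero _ hx.2.ne')
  · exact h

/-- **the first Wronskian is a level set of the second kind:**
`X·W(A, a·X^D·E) = −a·X^D·(X·W(E,A) − D·(A·E))` — the graft exponent `D` survives only as a LEVEL. [this work] -/
theorem X_mul_wronskian_graft (A E : ℝ[X]) (a : ℝ) (D : ℕ) :
    X * wronskian A (C a * X ^ D * E) = -(C a * X ^ D * (X * wronskian E A - C (D : ℝ) * (A * E))) := by
  simp only [wronskian, derivative_mul, derivative_C, zero_mul, zero_add, derivative_X_pow]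
  rcases Nat.eq_zero_or_pos D with rfl | hD
  · simp
    ring
  · obtain ⟨D', rfl⟩ : ∃ D', D = D' + 1 := ⟨D - 1, by omega⟩
    simp only [Nat.add_sub_cancel, pow_succ, Nat.cast_add, Nat.cast_one, map_add, map_one, map_natCast]
    ring

/-- hence `Z₊(W(A, a X^D E)) ≤ Z₊(X·W(E,A) − D·(A·E))` for `a ≠ 0` (the two differ by the unit `−a·X^{D}` on `(0,∞)`,
after one factor `X`). [this work] -/
theorem card_posRoots_wronskian_graft_le (A E : ℝ[X]) {a : ℝ} (ha : a ≠ 0) (D : ℕ) :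
    ((wronskian A (C a * X ^ D * E)).roots.toFinset.filter (fun x => 0 < x)).card ≤
      ((X * wronskian E A - C (D : ℝ) * (A * E)).roots.toFinset.filter (fun x => 0 < x)).card := by
  classical
  set W := wronskian A (C a * X ^ D * E) with hWdef
  set U := X * wronskian E A - C (D : ℝ) * (A * E) with hUdef
  have hid : X * W = -(C a * X ^ D * U) := by rw [hWdef, hUdef]; exact X_mul_wronskian_graft A E a D
  by_cases hW : W = 0
  · rw [hW]; simp
  have hU : U ≠ 0 := by
    intro hU
    apply hW
    have h : X * W = 0 := by rw [hid, hU, mul_zero, neg_zero]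
    rcases mul_eq_zero.1 h with h | h
    · exact absurd h X_ne_zero
    · exact h
  refine Finset.card_le_card fun x hx => ?_
  rw [Finset.mem_filter, Multiset.mem_toFinset, mem_roots hW, IsRoot.def] at hx
  rw [Finset.mem_filter, Multiset.mem_toFinset, mem_roots hU, IsRoot.def]
  refine ⟨?_, hx.2⟩
  have h := congrArg (fun p => Polynomial.eval x p) hid
  simp only [eval_mul, eval_X, eval_neg, eval_C, eval_pow, hx.1, mul_zero] at h
  have hax : C a ≠ 0 ∨ True := Or.inr trivial
  have hxD : a * x ^ D ≠ 0 := mul_ne_zero ha (pow_ne_zero _ hx.2.ne')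
  have : a * x ^ D * U.eval x = 0 := by linarith
  rcases mul_eq_zero.1 this with h' | h'
  · exact absurd h' hxD
  · exact h'

/-- ★ **THE TWO-DIGIT INFLECTION LAW** (all real polynomials `A`, `E`, every coupling `a`, EVERY exponent `D`):
`Z₊(A + a·X^D·E) ≤ Z₊(W(A·E, X·W(E,A))) + 4·Z₊(A) + 2·Z₊(E) + 2`.
The right-hand side is free of `D` and of `a`. [this work] -/
theorem card_posRoots_twoDigit_le (A E : ℝ[X]) (a : ℝ) (D : ℕ) :
    ((A + C a * X ^ D * E).roots.toFinset.filter (fun x => 0 < x)).card ≤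
      ((wronskian (A * E) (X * wronskian E A)).roots.toFinset.filter (fun x => 0 < x)).card +
        4 * (A.roots.toFinset.filter (fun x => 0 < x)).card +
        2 * (E.roots.toFinset.filter (fun x => 0 < x)).card + 2 := by
  classical
  by_cases ha : a = 0
  · rw [ha, C_0, zero_mul, zero_mul, add_zero]; omega
  by_cases hA : A = 0
  · subst hA
    have h := card_posRoots_C_mul_X_pow_mul_le a D E
    rw [zero_add]
    omega
  by_cases hE : E = 0
  · subst hE
    rw [mul_zero, add_zero]; omega
  -- step 1: level `−1` of `a X^D E` against `A`
  have h1 : ((A + C a * X ^ D * E).roots.toFinset.filter (fun x => 0 < x)).card ≤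
      ((wronskian A (C a * X ^ D * E)).roots.toFinset.filter (fun x => 0 < x)).card +
        2 * (A.roots.toFinset.filter (fun x => 0 < x)).card + 1 := by
    have h := card_posRoots_level_le (C a * X ^ D * E) A (-1) hA
    have heq : C a * X ^ D * E - C (-1 : ℝ) * A = A + C a * X ^ D * E := by
      rw [map_neg, map_one]; ring
    rwa [heq] at h
  -- the separators of step 1 are a level set (level `D`) of `X·W(E,A)` against `A·E`
  have h2 := card_posRoots_wronskian_graft_le A E ha D
  -- step 2
  have h3 := card_posRoots_level_le (X * wronskian E A) (A * E) (D : ℝ) (mul_ne_zero hA hE)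
  have h4 := Summit.ValiantsHypothesis.ValiantsHypothesis.Theorems.KPlusLogSqLaw.StaticTridiagonalRealPotential.card_posRoots_mul_le
    A E
  omega

/-- the law without coupling constant (`a = 1`). [this work] -/
theorem card_posRoots_twoDigit_le' (A E : ℝ[X]) (D : ℕ) :
    ((A + X ^ D * E).roots.toFinset.filter (fun x => 0 < x)).card ≤
      ((wronskian (A * E) (X * wronskian E A)).roots.toFinset.filter (fun x => 0 < x)).card +
        4 * (A.roots.toFinset.filter (fun x => 0 < x)).card +
        2 * (E.roots.toFinset.filter (fun x => 0 < x)).card + 2 := by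
  have h := card_posRoots_twoDigit_le A E 1 D
  rwa [C_1, one_mul] at h

end InflectionLaw

end Summit.ValiantsHypothesis.ValiantsHypothesis.Theorems.KPlusLogSqLaw.TowerGraft
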